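import Literature.Probability.RandomPlanarGeometry.LSW2004USTApproxLoops
import Literature.Probability.RandomPlanarGeometry.RadoConvergenceProofs
import Literature.Probability.RandomPlanarGeometry.ConformalMapCaratheodoryProofs
import Literature.Probability.RandomPlanarGeometry.ConformalRectangleProofs
import Literature.Probability.RandomPlanarGeometry.ConformalMapRiemannNormalisedProofs
import Literature.Probability.RandomPlanarGeometry.JordanDomainProofs
import HarnessLib

/-!
# [LSW04] p. 977: `R⁻¹ φ_R⁻¹ → φ⁻¹` uniformly — the normalised maps of the approximations converge

G. F. Lawler, O. Schramm, W. Werner, *Conformal invariance of planar loop-erased random walks and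
uniform spanning trees*, Ann. Probab. **32** (2004) 939–995 (**[LSW04]**), §4.3, p. 977: for the
grid approximations `D^R` of a smooth domain `D` and the conformal maps `φ_R : D^R → ℍ`,
`φ : D → ℍ` normalised by `a ↦ 0`, `b ↦ ∞`, `|φ(0)| = 1`, "`lim_{R → ∞} R⁻¹ φ_R⁻¹(z) = φ⁻¹(z)`,
where the convergence is uniform in `z ∈ ℍ̄`. (This follows, e.g., from Cor. 2.4 in [Po].)" This
is the hypothesis `hconv` of `USTPeano.drivingProcess_tendsto_of_thm44` (`LSW2004USTDriving.lean`),
and this file PROVES it (`USTPeano.tendstoUniformlyOn_lswMaps`), so that the named fact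
`USTPeano.drivingProcess_tendsto` is reduced to [LSW04] Thm. 4.4 exactly as printed
(`USTPeano.drivingProcess_tendsto_of_thm44_printed`; the identically-stated
`USTPeano.drivingProcess_tendsto_of_thm44'` of `LSW2004USTRado.lean`, landed in parallel by the other seat of
this fact, is the same corollary through that file's `tendstoUniformlyOn_inv_mul`).

Proof. Radó's theorem (`JordanDomain.rado_tendstoUniformlyOn_holds`, Pommerenke (1992)
Thm. 2.11, proved in the tree) applies to the rescaled approximations `Rₙ⁻¹ D^{Rₙ}` with the
re-timed boundary loops of `LSW2004USTApproxLoops.lean` (uniformly `13/Rₙ`-close to `∂D`) and the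
Riemann maps `gₙ`, `g` of `𝔻` normalised at `0` (`gₙ(0) = g(0) = 0`, positive derivative): `gₙ → g`
uniformly on `𝔻̄` for the Carathéodory extensions. The circle preimages `ζaₙ, ζbₙ` of the marked
vertices `Rₙ⁻¹ a^{Rₙ} → a`, `Rₙ⁻¹ b^{Rₙ} → b` then converge to the preimages `ζa ≠ ζb` of `a, b`
(compactness of the circle and injectivity of the extension of `g` on `𝔻̄`, Pommerenke Thm. 2.6).
The normalised chordal maps are explicit in these data (`lswOf`): `ℍ ∋ z ↦ g(ζb · C(c z + u))`
with `C` the Cayley map, `u = C⁻¹(ζb⁻¹ ζa) ∈ ℝ` and `c = |i - u|` (so that the preimage of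
`0 = g(0)` has modulus `1`); uniqueness of chordal uniformizing maps up to dilation
(`IsChordalUniformizing.exists_eq_trans_smul_holds`) and the normalisation identify the given maps
with these (`eqOn_of_isChordalUniformizing_of_norm_eq_one`); and the explicit Möbius maps converge
uniformly on `ℍ` (`norm_moebius_sub_le`), which together with the uniform continuity of the
extension of `g` on `𝔻̄` gives the claim.

Everything here is PROVED; no named fact is introduced.
-/

noncomputable section

open Set Function Filter Metric Complex
open _root_.Topology
open UpperHalfPlane (upperHalfPlaneSet)
open scoped NNReal Real

namespace Literature.Probability.RandomPlanarGeometry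

/-! ### Scaling a set back: `z ↦ c z` from `c⁻¹ S` onto `S` -/

namespace ConformalEquiv

/-- The **dilation** `z ↦ c z` (`c ≠ 0`) as a conformal equivalence from `c⁻¹ S` onto `S`.
Ahlfors (1979), Ch. 3 §3.1. [folklore] -/
def mulLeftOnto (c : ℂ) (hc : c ≠ 0) (S : Set ℂ) : ConformalEquiv ((fun z : ℂ ↦ c⁻¹ * z) '' S) S where
  toFun z := c * z
  invFun z := c⁻¹ * z
  source := (fun z : ℂ ↦ c⁻¹ * z) '' S
  target := S
  map_source' := by
    rintro _ ⟨z, hz, rfl⟩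
    rwa [← mul_assoc, mul_inv_cancel₀ hc, one_mul]
  map_target' z hz := ⟨z, hz, rfl⟩
  left_inv' z _ := by rw [← mul_assoc, inv_mul_cancel₀ hc, one_mul]
  right_inv' z _ := by rw [← mul_assoc, mul_inv_cancel₀ hc, one_mul]
  source_eq := rfl
  target_eq := rfl
  differentiableOn := (differentiableOn_const c).mul differentiableOn_id
  differentiableOn_symm := (differentiableOn_const c⁻¹).mul differentiableOn_id

/-- The dilation acts as `z ↦ c z`. [folklore] -/
@[simp] theorem mulLeftOnto_apply (c : ℂ) (hc : c ≠ 0) (S : Set ℂ) (z : ℂ) :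
    mulLeftOnto c hc S z = c * z := rfl

end ConformalEquiv

/-! ### The normalised chordal map built from a disc map and two circle points -/

section LSWOf

variable {G : Set ℂ}

/-- The real Cayley preimage `u` of the rotated circle point `ζb⁻¹ ζa`. [folklore] -/
def lswShift (ζa ζb : ℂ) : ℝ := (cayleyInvFun (ζb⁻¹ * ζa)).re

/-- The dilation factor `c = |i - u|` making the preimage of the base point unimodular.
[folklore] -/
def lswScale (ζa ζb : ℂ) : ℝ := ‖Complex.I - (lswShift ζa ζb : ℂ)‖

/-- `c = |i - u| ≥ 1 > 0`. [folklore] -/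
theorem lswScale_pos (ζa ζb : ℂ) : 0 < lswScale ζa ζb := by
  unfold lswScale
  refine norm_pos_iff.2 fun h ↦ ?_
  have := congrArg Complex.im h
  simp at this

/-- **The normalised chordal map** `ℍ → G` attached to a conformal map `F : 𝔻 → G` and two
circle points `ζa ≠ ζb`: `z ↦ F (ζb · C(c z + u))`, i.e. dilation by `c`, real translation by
`u`, the Cayley map `C`, the rotation by `ζb`, then `F` — the construction of
`MarkedDomain.exists_isChordalUniformizing_of_closedBall` with the extra dilation making the
preimage of `F(0)` unimodular ([LSW04] §4.2: "`φ` … takes `a` to `0`, `b` to `∞` and satisfies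
`|φ(0)| = 1`"). [cite: LawlerSchrammWerner2004, §4.2] -/
def lswOf (F : ConformalEquiv (ball (0 : ℂ) 1) G) (ζa ζb : ℂ) (hζb : ‖ζb‖ = 1) :
    ConformalEquiv upperHalfPlaneSet G :=
  (ConformalEquiv.smulUpperHalfPlane (lswScale ζa ζb) (lswScale_pos ζa ζb)).trans
    ((addRealUpperHalfPlane (lswShift ζa ζb)).trans (cayley.trans ((rotBall ζb hζb).trans F)))

/-- The Möbius part `z ↦ ζb · C(c z + u)` of the normalised chordal map. [folklore] -/
def lswMoebius (ζa ζb : ℂ) (z : ℂ) : ℂ :=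
  ζb * cayleyFun ((lswScale ζa ζb : ℂ) * z + lswShift ζa ζb)

/-- **Formula**: `lswOf F ζa ζb z = F (ζb · C(c z + u))`. [folklore] -/
theorem lswOf_apply (F : ConformalEquiv (ball (0 : ℂ) 1) G) (ζa ζb : ℂ) (hζb : ‖ζb‖ = 1) (z : ℂ) :
    lswOf F ζa ζb hζb z = F (lswMoebius ζa ζb z) := by
  simp [lswOf, lswMoebius, ConformalEquiv.trans_apply, Complex.real_smul]

/-- The Möbius part maps `ℍ` into `𝔻`. [folklore] -/
theorem lswMoebius_mem_ball (ζa ζb : ℂ) (hζb : ‖ζb‖ = 1) {z : ℂ} (hz : z ∈ upperHalfPlaneSet) :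
    lswMoebius ζa ζb z ∈ ball (0 : ℂ) 1 := by
  have h1 : (lswScale ζa ζb : ℂ) * z + lswShift ζa ζb ∈ upperHalfPlaneSet := by
    have := ((ConformalEquiv.smulUpperHalfPlane (lswScale ζa ζb) (lswScale_pos ζa ζb)).trans
      (addRealUpperHalfPlane (lswShift ζa ζb))).mapsTo hz
    simpa [ConformalEquiv.trans_apply, Complex.real_smul] using this
  have h2 := cayley.mapsTo h1
  exact (rotBall ζb hζb).mapsTo h2

/-- **The normalised chordal map is chordal uniformizing**: boundary value `Ψ(ζa)` at `0` and
`Ψ(ζb)` at `∞`, where `Ψ` is a continuous extension of `F` to the closed disc (Carathéodory).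
Replays the proof of `MarkedDomain.exists_isChordalUniformizing_of_closedBall`, followed by the
dilation (`IsChordalUniformizing.smul_trans`). [cite: AhlforsCA1979, Ch. 6 §1.1 Thm. 1] -/
theorem isChordalUniformizing_lswOf (M : MarkedDomain 2) (F : ConformalEquiv (ball (0 : ℂ) 1) M.carrier)
    {Ψ : ℂ → ℂ} (hΨc : ContinuousOn Ψ (closedBall 0 1)) (hΨeq : EqOn Ψ F (ball 0 1)) {ζa ζb : ℂ}
    (hζa : ‖ζa‖ = 1) (hζb : ‖ζb‖ = 1) (hne : ζa ≠ ζb) (ha : Ψ ζa = M.pt 0) (hb : Ψ ζb = M.pt 1) :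
    M.IsChordalUniformizing (lswOf F ζa ζb hζb) := by
  have hζb0 : ζb ≠ 0 := norm_ne_zero_iff.1 (by rw [hζb]; exact one_ne_zero)
  set ψ₂ : ConformalEquiv (ball (0 : ℂ) 1) M.carrier := (rotBall ζb hζb).trans F with hψ₂
  set Ψ₂ : ℂ → ℂ := fun w ↦ Ψ (ζb * w) with hΨ₂
  have hrot : MapsTo (fun w : ℂ ↦ ζb * w) (closedBall 0 1) (closedBall 0 1) := fun w hw ↦ by
    rw [mem_closedBall_zero_iff] at hw ⊢
    rwa [norm_mul, hζb, one_mul]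
  have hΨ₂c : ContinuousOn Ψ₂ (closedBall 0 1) :=
    hΨc.comp (continuous_const_mul ζb).continuousOn hrot
  have hΨ₂eq : EqOn Ψ₂ ψ₂ (ball 0 1) := fun w hw ↦ hΨeq ((rotBall ζb hζb).mapsTo hw)
  set ζ : ℂ := ζb⁻¹ * ζa with hζ
  have hζ1 : ‖ζ‖ = 1 := by rw [hζ, norm_mul, norm_inv, hζa, hζb, inv_one, one_mul]
  have hζne : ζ ≠ 1 := by
    intro h
    apply hne
    have : ζb * ζ = ζb := by rw [h, mul_one]
    rw [hζ, ← mul_assoc, mul_inv_cancel₀ hζb0, one_mul] at this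
    exact this
  have hζbζ : ζb * ζ = ζa := by rw [hζ, ← mul_assoc, mul_inv_cancel₀ hζb0, one_mul]
  set u : ℝ := lswShift ζa ζb with hu
  have hcu : cayleyFun u = ζ := by
    rw [hu, lswShift, ← hζ, ← cayleyInvFun_eq_ofReal_re hζ1, cayleyFun_cayleyInvFun hζne]
  set φ' : ConformalEquiv upperHalfPlaneSet M.carrier := cayley.trans ψ₂ with hφ'
  have hΨ₂eq' : EqOn Ψ₂ (cayley.symm.trans φ') (ball 0 1) := fun w hw ↦ by
    rw [hΨ₂eq hw]
    change ψ₂ w = ψ₂ (cayley (cayley.symm w))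
    rw [cayley.apply_symm_apply hw]
  have key : M.IsChordalUniformizing ((addRealUpperHalfPlane u).trans φ') := by
    refine ⟨?_, ?_⟩
    · have h1 : Tendsto φ' (𝓝[upperHalfPlaneSet] u) (𝓝 (Ψ₂ (cayleyFun u))) :=
        JordanDomain.tendsto_nhdsWithin_of_extension φ' hΨ₂c hΨ₂eq' (by simp)
      rw [hcu, hΨ₂] at h1
      simp only [hζbζ, ha] at h1
      exact h1.comp (tendsto_add_real_nhdsWithin_zero u)
    · have h1 : Tendsto φ' (cocompact ℂ ⊓ 𝓟 upperHalfPlaneSet) (𝓝 (Ψ₂ 1)) :=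
        JordanDomain.tendsto_cocompact_of_extension φ' hΨ₂c hΨ₂eq'
      rw [hΨ₂] at h1
      simp only [mul_one, hb] at h1
      exact h1.comp (tendsto_add_real_cocompact_inf u)
  exact key.smul_trans (lswScale ζa ζb) (lswScale_pos ζa ζb)

/-- The point `z₀ = c⁻¹ (i - u)` of `ℍ`, of modulus `1`, is sent to `F 0` by the normalised
chordal map. [folklore] -/
theorem lswOf_base (F : ConformalEquiv (ball (0 : ℂ) 1) G) (ζa ζb : ℂ) (hζb : ‖ζb‖ = 1) :
    lswOf F ζa ζb hζb ((lswScale ζa ζb : ℂ)⁻¹ * (Complex.I - lswShift ζa ζb)) = F 0 ∧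
      (lswScale ζa ζb : ℂ)⁻¹ * (Complex.I - lswShift ζa ζb) ∈ upperHalfPlaneSet ∧
      ‖(lswScale ζa ζb : ℂ)⁻¹ * (Complex.I - lswShift ζa ζb)‖ = 1 := by
  have hc := lswScale_pos ζa ζb
  have hc0 : (lswScale ζa ζb : ℂ) ≠ 0 := by exact_mod_cast hc.ne'
  refine ⟨?_, ?_, ?_⟩
  · rw [lswOf_apply, lswMoebius, ← mul_assoc, mul_inv_cancel₀ hc0, one_mul, sub_add_cancel]
    simp [cayleyFun_apply]
  · change 0 < ((lswScale ζa ζb : ℂ)⁻¹ * (Complex.I - lswShift ζa ζb)).im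
    rw [← Complex.ofReal_inv]
    simp [Complex.mul_im, hc]
  · rw [norm_mul, norm_inv, Complex.norm_real, Real.norm_of_nonneg hc.le, lswScale,
      inv_mul_cancel₀]
    exact (lswScale_pos ζa ζb).ne'

/-- **The normalisation `|φ⁻¹(F 0)| = 1`** of the normalised chordal map. [cite: LawlerSchrammWerner2004, §4.2] -/
theorem norm_lswOf_symm (F : ConformalEquiv (ball (0 : ℂ) 1) G) (ζa ζb : ℂ) (hζb : ‖ζb‖ = 1) :
    ‖(lswOf F ζa ζb hζb).symm (F 0)‖ = 1 := by
  obtain ⟨h1, h2, h3⟩ := lswOf_base F ζa ζb hζb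
  rw [← h1, (lswOf F ζa ζb hζb).symm_apply_apply h2, h3]

end LSWOf

/-! ### Uniqueness of the normalised chordal map -/

namespace MarkedDomain

/-- **Two chordal uniformizing maps with `|φ⁻¹(0)| = |ψ⁻¹(0)| = 1` coincide on `ℍ`** (`0` in the
domain): by `IsChordalUniformizing.exists_eq_trans_smul` they differ by a dilation `z ↦ c z`, and
then `φ⁻¹(0) = c⁻¹ ψ⁻¹(0)` forces `c = 1`. [LSW04] §4.2 (the normalisation pins the map down).
[cite: LawlerSchrammWerner2004, §4.2] -/
theorem eqOn_of_isChordalUniformizing_of_norm_eq_one {M : MarkedDomain 2}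
    {φ ψ : ConformalEquiv upperHalfPlaneSet M.carrier} (hφ : M.IsChordalUniformizing φ)
    (hψ : M.IsChordalUniformizing ψ) (h0 : (0 : ℂ) ∈ M.carrier) (nφ : ‖φ.symm 0‖ = 1)
    (nψ : ‖ψ.symm 0‖ = 1) : EqOn φ ψ upperHalfPlaneSet := by
  obtain ⟨c, hc, heq⟩ := IsChordalUniformizing.exists_eq_trans_smul_holds hψ hφ
  -- `heq : EqOn φ ((smul c).trans ψ) ℍ`
  set w := ψ.symm 0 with hw
  have hwH : w ∈ upperHalfPlaneSet := ψ.symm_mapsTo h0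
  have hcw : (c⁻¹ : ℝ) • w ∈ upperHalfPlaneSet :=
    (ConformalEquiv.smulUpperHalfPlane c hc).symm_mapsTo hwH
  have h1 : φ ((c⁻¹ : ℝ) • w) = 0 := by
    rw [heq hcw, ConformalEquiv.trans_apply, ConformalEquiv.smulUpperHalfPlane_apply, smul_smul,
      mul_inv_cancel₀ hc.ne', one_smul, hw, ψ.apply_symm_apply h0]
  have h2 : φ.symm 0 = (c⁻¹ : ℝ) • w := by rw [← h1, φ.symm_apply_apply hcw]
  have hc1 : c = 1 := by
    have := nφ
    rw [h2, norm_smul, Real.norm_eq_abs, abs_of_pos (inv_pos.2 hc), nψ, mul_one] at this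
    have := congrArg (·⁻¹) this
    simpa using this
  intro z hz
  rw [heq hz, ConformalEquiv.trans_apply, ConformalEquiv.smulUpperHalfPlane_apply, hc1, one_smul]

end MarkedDomain

/-! ### Normalised Riemann maps of the disc onto a Jordan domain -/

namespace JordanDomain

/-- **The Riemann map of `𝔻` onto a Jordan domain normalised at `w₀`**: `f(0) = w₀`, `f'(0) > 0`
(the inverse of the normalised map of `existsUnique_conformalEquiv_ball_holds`; its derivative at
`0` is the inverse of a positive real). Ahlfors (1979), Ch. 6 §1.1, Thm. 1. [cite: AhlforsCA1979, Ch. 6 §1.1 Thm. 1] -/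
theorem exists_normalised (G : JordanDomain) {w₀ : ℂ} (h0 : w₀ ∈ G.carrier) :
    ∃ f : ConformalEquiv (ball (0 : ℂ) 1) G.carrier,
      f 0 = w₀ ∧ 0 < (deriv f 0).re ∧ (deriv f 0).im = 0 := by
  obtain ⟨φ, ⟨hφ0, hre, him⟩, -⟩ :=
    existsUnique_conformalEquiv_ball_holds G.isOpen (isSimplyConnected_holds G) G.carrier_ne_univ h0
  refine ⟨φ.symm, ?_, ?_⟩
  · have := φ.symm_apply_apply h0
    rwa [hφ0] at this
  · have h := φ.deriv_symm_mul_deriv G.isOpen h0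
    rw [hφ0] at h
    exact Rado.re_pos_im_zero_of_mul_eq_one hre him h

/-- A chosen normalised Riemann map. [folklore] -/
def normalisedMap (G : JordanDomain) {w₀ : ℂ} (h0 : w₀ ∈ G.carrier) :
    ConformalEquiv (ball (0 : ℂ) 1) G.carrier :=
  (G.exists_normalised h0).choose

/-- The chosen map is normalised. [folklore] -/
theorem normalisedMap_spec (G : JordanDomain) {w₀ : ℂ} (h0 : w₀ ∈ G.carrier) :
    G.normalisedMap h0 0 = w₀ ∧ 0 < (deriv (G.normalisedMap h0) 0).re ∧
      (deriv (G.normalisedMap h0) 0).im = 0 :=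
  (G.exists_normalised h0).choose_spec

/-- A chosen Carathéodory extension of a disc map onto a Jordan domain (Pommerenke Thm. 2.6).
[cite: PommerenkeBBCM1992, Thm. 2.6] -/
def caratheodoryExt (G : JordanDomain) (f : ConformalEquiv (ball (0 : ℂ) 1) G.carrier) : ℂ → ℂ :=
  (exists_continuousOn_extension_holds G f).choose

/-- Properties of the chosen Carathéodory extension: continuous on `𝔻̄`, equal to `f` on `𝔻`,
a bijection `𝔻̄ → closure G` and `∂𝔻 → ∂G`. [cite: PommerenkeBBCM1992, Thm. 2.6] -/
theorem caratheodoryExt_spec (G : JordanDomain) (f : ConformalEquiv (ball (0 : ℂ) 1) G.carrier) :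
    ContinuousOn (G.caratheodoryExt f) (closedBall 0 1) ∧ EqOn (G.caratheodoryExt f) f (ball 0 1) ∧
      BijOn (G.caratheodoryExt f) (closedBall 0 1) (closure G.carrier) ∧
      BijOn (G.caratheodoryExt f) (sphere 0 1) (frontier G.carrier) :=
  (exists_continuousOn_extension_holds G f).choose_spec

end JordanDomain

/-! ### The Möbius parts converge uniformly on `ℍ` -/

section Moebius

/-- `|w + i| ≥ 1` on the closed upper half-plane. [folklore] -/
theorem one_le_norm_add_I {w : ℂ} (hw : 0 ≤ w.im) : 1 ≤ ‖w + Complex.I‖ := by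
  have h := Complex.abs_im_le_norm (w + Complex.I)
  have e : (w + Complex.I).im = w.im + 1 := by simp
  rw [e, abs_of_nonneg (by linarith)] at h
  linarith

/-- **Lipschitz-type estimate for the Cayley map**: `|C(w) - C(w')| ≤ 2|w - w'|/|w' + i|` on the
closed upper half-plane (`C(w) - C(w') = 2i(w - w')/((w + i)(w' + i))` and `|w + i| ≥ 1`).
[folklore] -/
theorem norm_cayleyFun_sub_le_div_norm_add_I {w w' : ℂ} (hw : 0 ≤ w.im) (hw' : 0 ≤ w'.im) :
    ‖cayleyFun w - cayleyFun w'‖ ≤ 2 * ‖w - w'‖ / ‖w' + Complex.I‖ := by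
  have hne : w + Complex.I ≠ 0 := add_I_ne_zero hw
  have hne' : w' + Complex.I ≠ 0 := add_I_ne_zero hw'
  have e : cayleyFun w - cayleyFun w' = 2 * Complex.I * (w - w') / ((w + Complex.I) * (w' + Complex.I)) := by
    rw [cayleyFun_apply, cayleyFun_apply]
    field_simp
    ring
  rw [e, norm_div, norm_mul, norm_mul, norm_mul, Complex.norm_I, mul_one, Complex.norm_two]
  have h1 := one_le_norm_add_I hw
  have hpos' : 0 < ‖w' + Complex.I‖ := lt_of_lt_of_le one_pos (one_le_norm_add_I hw')
  rw [div_le_div_iff₀ (mul_pos (lt_of_lt_of_le one_pos h1) hpos') hpos']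
  have : 0 ≤ 2 * ‖w - w'‖ * ‖w' + Complex.I‖ := by positivity
  nlinarith

/-- The real Cayley preimage depends continuously on the circle points (away from `ζa = ζb`).
[folklore] -/
theorem tendsto_lswShift {ζa ζb : ℕ → ℂ} {a b : ℂ} (ha : Tendsto ζa atTop (𝓝 a))
    (hb : Tendsto ζb atTop (𝓝 b)) (hb0 : b ≠ 0) (hab : b⁻¹ * a ≠ 1) :
    Tendsto (fun n ↦ lswShift (ζa n) (ζb n)) atTop (𝓝 (lswShift a b)) := by
  unfold lswShift
  have h1 : Tendsto (fun n ↦ (ζb n)⁻¹ * ζa n) atTop (𝓝 (b⁻¹ * a)) := (hb.inv₀ hb0).mul ha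
  have h2 : ContinuousAt cayleyInvFun (b⁻¹ * a) :=
    differentiableOn_cayleyInvFun.continuousOn.continuousAt (isOpen_ne.mem_nhds hab)
  exact (Complex.continuous_re.tendsto _).comp (h2.tendsto.comp h1)

/-- The dilation factor depends continuously on the circle points. [folklore] -/
theorem tendsto_lswScale {ζa ζb : ℕ → ℂ} {a b : ℂ} (ha : Tendsto ζa atTop (𝓝 a))
    (hb : Tendsto ζb atTop (𝓝 b)) (hb0 : b ≠ 0) (hab : b⁻¹ * a ≠ 1) :
    Tendsto (fun n ↦ lswScale (ζa n) (ζb n)) atTop (𝓝 (lswScale a b)) := by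
  unfold lswScale
  exact ((continuous_norm.comp (continuous_const.sub Complex.continuous_ofReal)).tendsto _).comp
    (tendsto_lswShift ha hb hb0 hab)

/-- **Pointwise bound for the Möbius parts**: for `z ∈ ℍ`,
`|M'(z) - M(z)| ≤ |ζb' - ζb| + 2|c' - c|(2 + |u|)/c + 2|u' - u|`, uniformly in `z` (the factor
`|z|` coming from the dilations is absorbed by `|c z + u + i| ≳ c|z|`). [folklore] -/
theorem norm_moebius_sub_le {ζa ζb ζa' ζb' : ℂ} (hζb : ‖ζb‖ = 1) {z : ℂ}
    (hz : z ∈ upperHalfPlaneSet) :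
    ‖lswMoebius ζa' ζb' z - lswMoebius ζa ζb z‖ ≤
      ‖ζb' - ζb‖ + (2 * |lswScale ζa' ζb' - lswScale ζa ζb| * (2 + |lswShift ζa ζb|) / lswScale ζa ζb
        + 2 * |lswShift ζa' ζb' - lswShift ζa ζb|) := by
  set c := lswScale ζa ζb with hc
  set c' := lswScale ζa' ζb' with hc'
  set u := lswShift ζa ζb with hu
  set u' := lswShift ζa' ζb' with hu'
  have hcpos : 0 < c := lswScale_pos ζa ζb
  have hc'pos : 0 < c' := lswScale_pos ζa' ζb'
  have hz' : 0 < z.im := hz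
  set w : ℂ := (c : ℂ) * z + u with hw
  set w' : ℂ := (c' : ℂ) * z + u' with hw'
  have hwim : 0 ≤ w.im := by
    have : w.im = c * z.im := by simp [hw]
    rw [this]; positivity
  have hw'im : 0 ≤ w'.im := by
    have : w'.im = c' * z.im := by simp [hw']
    rw [this]; positivity
  have hX : ‖cayleyFun w‖ ≤ 1 := norm_cayleyFun_le_one hwim
  have hX' : ‖cayleyFun w'‖ ≤ 1 := norm_cayleyFun_le_one hw'im
  -- the rotation part
  have h1 : ‖lswMoebius ζa' ζb' z - lswMoebius ζa ζb z‖ ≤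
      ‖ζb' - ζb‖ + ‖cayleyFun w' - cayleyFun w‖ := by
    have e : lswMoebius ζa' ζb' z - lswMoebius ζa ζb z =
        (ζb' - ζb) * cayleyFun w' + ζb * (cayleyFun w' - cayleyFun w) := by
      simp only [lswMoebius, ← hw, ← hw', ← hc, ← hc', ← hu, ← hu']; ring
    rw [e]
    refine (norm_add_le _ _).trans (add_le_add ?_ ?_)
    · rw [norm_mul]; exact mul_le_of_le_one_right (norm_nonneg _) hX'
    · rw [norm_mul, hζb, one_mul]
  -- the Cayley part
  have h2 : ‖cayleyFun w' - cayleyFun w‖ ≤ 2 * ‖w' - w‖ / ‖w + Complex.I‖ :=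
    norm_cayleyFun_sub_le_div_norm_add_I hw'im hwim
  have hwI : 1 ≤ ‖w + Complex.I‖ := one_le_norm_add_I hwim
  have hwIpos : 0 < ‖w + Complex.I‖ := lt_of_lt_of_le one_pos hwI
  -- `|z| ≤ (|w + i| + 1 + |u|)/c`
  have hzle : c * ‖z‖ ≤ ‖w + Complex.I‖ + 1 + |u| := by
    have e : (c : ℂ) * z = (w + Complex.I) - Complex.I - u := by rw [hw]; ring
    have : ‖(c : ℂ) * z‖ ≤ ‖w + Complex.I‖ + ‖Complex.I‖ + ‖(u : ℂ)‖ := by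
      rw [e]; exact (norm_sub_le _ _).trans (add_le_add (norm_sub_le _ _) le_rfl)
    rwa [norm_mul, Complex.norm_real, Real.norm_of_nonneg hcpos.le, Complex.norm_I, Complex.norm_real,
      Real.norm_eq_abs] at this
  -- `|w' - w| ≤ |c' - c| |z| + |u' - u|`
  have hww : ‖w' - w‖ ≤ |c' - c| * ‖z‖ + |u' - u| := by
    have e : w' - w = ((c' : ℂ) - c) * z + ((u' : ℂ) - u) := by rw [hw, hw']; ring
    rw [e]
    refine (norm_add_le _ _).trans (add_le_add ?_ ?_)
    · rw [norm_mul, ← Complex.ofReal_sub, Complex.norm_real, Real.norm_eq_abs]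
    · rw [← Complex.ofReal_sub, Complex.norm_real, Real.norm_eq_abs]
  have h3 : 2 * ‖w' - w‖ / ‖w + Complex.I‖ ≤
      2 * |c' - c| * (2 + |u|) / c + 2 * |u' - u| := by
    rw [div_le_iff₀ hwIpos]
    have hA : |c' - c| * ‖z‖ ≤ |c' - c| * (‖w + Complex.I‖ + 1 + |u|) / c := by
      rw [le_div_iff₀ hcpos]
      calc |c' - c| * ‖z‖ * c = |c' - c| * (c * ‖z‖) := by ring
        _ ≤ |c' - c| * (‖w + Complex.I‖ + 1 + |u|) :=
          mul_le_mul_of_nonneg_left hzle (abs_nonneg _)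
    have hB : (‖w + Complex.I‖ + 1 + |u|) ≤ (2 + |u|) * ‖w + Complex.I‖ := by
      nlinarith [abs_nonneg u]
    have hC : |c' - c| * (‖w + Complex.I‖ + 1 + |u|) / c ≤ |c' - c| * (2 + |u|) / c * ‖w + Complex.I‖ := by
      rw [div_mul_eq_mul_div, div_le_div_iff_of_pos_right hcpos]
      calc |c' - c| * (‖w + Complex.I‖ + 1 + |u|) ≤ |c' - c| * ((2 + |u|) * ‖w + Complex.I‖) :=
            mul_le_mul_of_nonneg_left hB (abs_nonneg _)
        _ = |c' - c| * (2 + |u|) * ‖w + Complex.I‖ := by ring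
    have hD : |u' - u| ≤ |u' - u| * ‖w + Complex.I‖ := le_mul_of_one_le_right (abs_nonneg _) hwI
    calc 2 * ‖w' - w‖ ≤ 2 * (|c' - c| * ‖z‖ + |u' - u|) := by linarith
      _ ≤ 2 * (|c' - c| * (2 + |u|) / c * ‖w + Complex.I‖ + |u' - u| * ‖w + Complex.I‖) := by
        linarith [hA.trans hC]
      _ = (2 * |c' - c| * (2 + |u|) / c + 2 * |u' - u|) * ‖w + Complex.I‖ := by ring
  linarith

/-- **Uniform convergence of the Möbius parts on `ℍ`** when the circle points converge to a pair
of distinct circle points. [folklore] -/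
theorem tendstoUniformlyOn_lswMoebius {ζa ζb : ℕ → ℂ} {a b : ℂ} (ha : Tendsto ζa atTop (𝓝 a))
    (hb : Tendsto ζb atTop (𝓝 b)) (hbn : ‖b‖ = 1) (hab : a ≠ b) :
    TendstoUniformlyOn (fun n ↦ lswMoebius (ζa n) (ζb n)) (lswMoebius a b) atTop upperHalfPlaneSet := by
  have hb0 : b ≠ 0 := norm_ne_zero_iff.1 (by rw [hbn]; exact one_ne_zero)
  have hab' : b⁻¹ * a ≠ 1 := by
    intro h
    apply hab
    have := congrArg (b * ·) h
    simpa [← mul_assoc, mul_inv_cancel₀ hb0] using this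
  -- the bound tends to `0`
  have hB : Tendsto (fun n ↦ ‖ζb n - b‖ + (2 * |lswScale (ζa n) (ζb n) - lswScale a b| *
      (2 + |lswShift a b|) / lswScale a b + 2 * |lswShift (ζa n) (ζb n) - lswShift a b|)) atTop (𝓝 0) := by
    have h1 : Tendsto (fun n ↦ ‖ζb n - b‖) atTop (𝓝 0) := by
      simpa using (hb.sub_const b).norm
    have h2 : Tendsto (fun n ↦ |lswScale (ζa n) (ζb n) - lswScale a b|) atTop (𝓝 0) := by
      simpa using ((tendsto_lswScale ha hb hb0 hab').sub_const (lswScale a b)).abs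
    have h3 : Tendsto (fun n ↦ |lswShift (ζa n) (ζb n) - lswShift a b|) atTop (𝓝 0) := by
      simpa using ((tendsto_lswShift ha hb hb0 hab').sub_const (lswShift a b)).abs
    have h4 : Tendsto (fun n ↦ 2 * |lswScale (ζa n) (ζb n) - lswScale a b| * (2 + |lswShift a b|) /
        lswScale a b + 2 * |lswShift (ζa n) (ζb n) - lswShift a b|) atTop
        (𝓝 (2 * 0 * (2 + |lswShift a b|) / lswScale a b + 2 * 0)) :=
      (((h2.const_mul 2).mul_const (2 + |lswShift a b|)).div_const (lswScale a b)).add (h3.const_mul 2)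
    have := h1.add h4
    simpa using this
  rw [Metric.tendstoUniformlyOn_iff]
  intro ε hε
  filter_upwards [(tendsto_order.1 hB).2 ε hε] with n hn z hz
  rw [dist_comm, dist_eq_norm]
  exact (norm_moebius_sub_le hbn hz).trans_lt hn

end Moebius

/-! ### Convergence of preimages under uniformly convergent injective extensions -/

/-- **Preimages converge**: if `Φₙ → Φ` uniformly on a compact `K`, `Φ` is continuous and
injective on `K`, `ζₙ ∈ K`, `ζ ∈ K` and `Φₙ(ζₙ) → Φ(ζ)`, then `ζₙ → ζ` (every subsequential limit
`ζ'` of `ζₙ` has `Φ(ζ') = Φ(ζ)`). [folklore] -/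
theorem tendsto_of_tendstoUniformlyOn_of_injOn {Φ : ℕ → ℂ → ℂ} {Φlim : ℂ → ℂ} {K : Set ℂ}
    (hK : IsCompact K) (hunif : TendstoUniformlyOn Φ Φlim atTop K) (hcont : ContinuousOn Φlim K)
    (hinj : InjOn Φlim K) {ζ : ℕ → ℂ} (hζ : ∀ n, ζ n ∈ K) {ζlim : ℂ} (hζlim : ζlim ∈ K)
    (hval : Tendsto (fun n ↦ Φ n (ζ n)) atTop (𝓝 (Φlim ζlim))) : Tendsto ζ atTop (𝓝 ζlim) := by
  refine tendsto_of_subseq_tendsto fun ns hns ↦ ?_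
  obtain ⟨ζ', hζ'K, ms, hms, hlim⟩ := hK.tendsto_subseq fun n ↦ hζ (ns n)
  refine ⟨ms, ?_⟩
  suffices ζ' = ζlim by rwa [← this]
  have hidx : Tendsto (ns ∘ ms) atTop atTop := hns.comp hms.tendsto_atTop
  -- `Φ (ζ ∘ ns ∘ ms) → Φ ζ'` by continuity within `K`
  have hA : Tendsto (fun k ↦ Φlim (ζ (ns (ms k)))) atTop (𝓝 (Φlim ζ')) :=
    (hcont ζ' hζ'K).tendsto.comp (tendsto_nhdsWithin_iff.2 ⟨hlim, Eventually.of_forall fun k ↦ hζ _⟩)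
  -- `Φ_{n_k} (ζ_{n_k}) → Φ ζ` along the subsequence
  have hB : Tendsto (fun k ↦ Φ (ns (ms k)) (ζ (ns (ms k)))) atTop (𝓝 (Φlim ζlim)) := hval.comp hidx
  -- the two sequences are asymptotically equal by uniform convergence
  have hAB : Tendsto (fun k ↦ dist (Φ (ns (ms k)) (ζ (ns (ms k)))) (Φlim (ζ (ns (ms k))))) atTop (𝓝 0) := by
    rw [Metric.tendsto_nhds]
    intro ε hε
    have hev := (Metric.tendstoUniformlyOn_iff.1 hunif ε hε)
    filter_upwards [hidx.eventually hev] with k hk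
    rw [Real.dist_eq, sub_zero, abs_of_nonneg dist_nonneg, dist_comm]
    exact hk _ (hζ _)
  have hA' : Tendsto (fun k ↦ Φlim (ζ (ns (ms k)))) atTop (𝓝 (Φlim ζlim)) := hB.congr_dist hAB
  exact hinj hζ'K hζlim (tendsto_nhds_unique hA hA')

namespace USTPeano

/-! ### The normalised maps of an approximation and of the limit domain, explicitly -/

namespace IsApproximation

variable {D : SmoothDomain} {R : ℝ} {Δ : Domain}

/-- The Riemann map of `𝔻` onto the rescaled approximation normalised at `0`. [folklore] -/
def discMap (h : IsApproximation D R Δ) (hR : D.glueScale ≤ R) : ConformalEquiv (ball (0 : ℂ) 1) (h.jordan hR).carrier :=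
  (h.jordan hR).normalisedMap (h.zero_mem_jordan hR)

/-- Its Carathéodory extension. [folklore] -/
def discExt (h : IsApproximation D R Δ) (hR : D.glueScale ≤ R) : ℂ → ℂ :=
  (h.jordan hR).caratheodoryExt (h.discMap hR)

/-- The circle preimage of the rescaled initial vertex `R⁻¹ a^R`. [folklore] -/
def preA (h : IsApproximation D R Δ) (hR : D.glueScale ≤ R) : ℂ :=
  (((h.jordan hR).caratheodoryExt_spec (h.discMap hR)).2.2.2.surjOn (h.a_mem_frontier_jordan hR)).choose

/-- The circle preimage of the rescaled terminal vertex `R⁻¹ b^R`. [folklore] -/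
def preB (h : IsApproximation D R Δ) (hR : D.glueScale ≤ R) : ℂ :=
  (((h.jordan hR).caratheodoryExt_spec (h.discMap hR)).2.2.2.surjOn (h.b_mem_frontier_jordan hR)).choose

/-- `preA` is a circle point over `R⁻¹ a^R`. [folklore] -/
theorem preA_spec (h : IsApproximation D R Δ) (hR : D.glueScale ≤ R) :
    h.preA hR ∈ sphere (0 : ℂ) 1 ∧ h.discExt hR (h.preA hR) = ((R : ℂ))⁻¹ * peanoPt Δ.a :=
  (((h.jordan hR).caratheodoryExt_spec (h.discMap hR)).2.2.2.surjOn (h.a_mem_frontier_jordan hR)).choose_spec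

/-- `preB` is a circle point over `R⁻¹ b^R`. [folklore] -/
theorem preB_spec (h : IsApproximation D R Δ) (hR : D.glueScale ≤ R) :
    h.preB hR ∈ sphere (0 : ℂ) 1 ∧ h.discExt hR (h.preB hR) = ((R : ℂ))⁻¹ * peanoPt Δ.b :=
  (((h.jordan hR).caratheodoryExt_spec (h.discMap hR)).2.2.2.surjOn (h.b_mem_frontier_jordan hR)).choose_spec

/-- `a^R ≠ b^R`. [folklore] -/
theorem peanoPt_a_ne_b (Δ : Domain) : peanoPt Δ.a ≠ peanoPt Δ.b := by
  rw [← Δ.toDobrushinDomain_pt_zero, ← Δ.toDobrushinDomain_pt_one]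
  exact fun h ↦ absurd (Δ.toDobrushinDomain.pt_injective h) (by decide)

/-- The two circle preimages are distinct. [folklore] -/
theorem preA_ne_preB (h : IsApproximation D R Δ) (hR : D.glueScale ≤ R) : h.preA hR ≠ h.preB hR := by
  intro e
  have h1 := (h.preA_spec hR).2
  have h2 := (h.preB_spec hR).2
  rw [e, h2] at h1
  have hR0 : ((R : ℂ))⁻¹ ≠ 0 := inv_ne_zero (by exact_mod_cast (D.glueScale_pos.trans_le hR).ne')
  exact peanoPt_a_ne_b Δ (mul_left_cancel₀ hR0 h1).symm

/-- The Riemann map composed with the dilation `z ↦ R z`: a conformal map of `𝔻` onto `D^R` with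
`0 ↦ 0`. [folklore] -/
def discMapScaled (h : IsApproximation D R Δ) (hR : D.glueScale ≤ R) : ConformalEquiv (ball (0 : ℂ) 1) Δ.carrier :=
  (h.discMap hR).trans (ConformalEquiv.mulLeftOnto (R : ℂ)
    (by exact_mod_cast (D.glueScale_pos.trans_le hR).ne') Δ.carrier)

/-- **The normalised map of the approximation, explicitly** (`lswOf` of the scaled Riemann map and
the two circle preimages). [cite: LawlerSchrammWerner2004, §4.3] -/
def lswMap (h : IsApproximation D R Δ) (hR : D.glueScale ≤ R) : ConformalEquiv upperHalfPlaneSet Δ.carrier :=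
  lswOf (h.discMapScaled hR) (h.preA hR) (h.preB hR) (mem_sphere_zero_iff_norm.1 (h.preB_spec hR).1)

/-- The explicit map is a normalised map in the sense of [LSW04] (`Domain.IsLSWMap`).
[cite: LawlerSchrammWerner2004, §4.3] -/
theorem isLSWMap_lswMap (h : IsApproximation D R Δ) (hR : D.glueScale ≤ R) : Δ.IsLSWMap (h.lswMap hR) := by
  have hR0 : 0 < R := D.glueScale_pos.trans_le hR
  have hRc : (R : ℂ) ≠ 0 := by exact_mod_cast hR0.ne'
  obtain ⟨hc, heq, -, -⟩ := (h.jordan hR).caratheodoryExt_spec (h.discMap hR)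
  have hF0 : h.discMapScaled hR 0 = 0 := by
    simp only [discMapScaled, ConformalEquiv.trans_apply, ConformalEquiv.mulLeftOnto_apply]
    rw [show h.discMap hR 0 = 0 from ((h.jordan hR).normalisedMap_spec (h.zero_mem_jordan hR)).1, mul_zero]
  refine ⟨?_, ?_⟩
  · refine isChordalUniformizing_lswOf Δ.toDobrushinDomain (h.discMapScaled hR)
      (Ψ := fun w ↦ (R : ℂ) * h.discExt hR w) ?_ ?_ (mem_sphere_zero_iff_norm.1 (h.preA_spec hR).1)
      (mem_sphere_zero_iff_norm.1 (h.preB_spec hR).1) (h.preA_ne_preB hR) ?_ ?_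
    · exact continuousOn_const.mul hc
    · intro w hw
      simp only [discMapScaled, ConformalEquiv.trans_apply, ConformalEquiv.mulLeftOnto_apply, discExt, heq hw]
    · simp only [(h.preA_spec hR).2, ← mul_assoc, mul_inv_cancel₀ hRc, one_mul, Δ.toDobrushinDomain_pt_zero]
    · simp only [(h.preB_spec hR).2, ← mul_assoc, mul_inv_cancel₀ hRc, one_mul, Δ.toDobrushinDomain_pt_one]
  · have := norm_lswOf_symm (h.discMapScaled hR) (h.preA hR) (h.preB hR)
      (mem_sphere_zero_iff_norm.1 (h.preB_spec hR).1)
    rwa [hF0] at this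

/-- **Every normalised map of the approximation is the explicit one** (on `ℍ`). [cite: LawlerSchrammWerner2004, §4.3] -/
theorem eqOn_lswMap (h : IsApproximation D R Δ) (hR : D.glueScale ≤ R)
    {φ : ConformalEquiv upperHalfPlaneSet Δ.carrier} (hφ : Δ.IsLSWMap φ) :
    EqOn φ (h.lswMap hR) upperHalfPlaneSet :=
  MarkedDomain.eqOn_of_isChordalUniformizing_of_norm_eq_one hφ.1 (h.isLSWMap_lswMap hR).1 h.2.2 hφ.2
    (h.isLSWMap_lswMap hR).2

/-- **Formula for the rescaled normalised map**: on `ℍ`,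
`R⁻¹ φ(z) = Ψ_R (ζb · C(c z + u))` with `Ψ_R` the extension of the Riemann map of `R⁻¹ D^R`.
[cite: LawlerSchrammWerner2004, §4.3] -/
theorem inv_mul_apply_eq (h : IsApproximation D R Δ) (hR : D.glueScale ≤ R)
    {φ : ConformalEquiv upperHalfPlaneSet Δ.carrier} (hφ : Δ.IsLSWMap φ) {z : ℂ} (hz : z ∈ upperHalfPlaneSet) :
    ((R : ℂ))⁻¹ * φ z = h.discExt hR (lswMoebius (h.preA hR) (h.preB hR) z) := by
  have hR0 : 0 < R := D.glueScale_pos.trans_le hR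
  have hRc : (R : ℂ) ≠ 0 := by exact_mod_cast hR0.ne'
  obtain ⟨-, heq, -, -⟩ := (h.jordan hR).caratheodoryExt_spec (h.discMap hR)
  have hw := lswMoebius_mem_ball (h.preA hR) (h.preB hR) (mem_sphere_zero_iff_norm.1 (h.preB_spec hR).1) hz
  rw [h.eqOn_lswMap hR hφ hz, lswMap, lswOf_apply, discExt, heq hw]
  simp only [discMapScaled, ConformalEquiv.trans_apply, ConformalEquiv.mulLeftOnto_apply, ← mul_assoc,
    inv_mul_cancel₀ hRc, one_mul]

end IsApproximation

namespace SmoothDomain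

variable (D : SmoothDomain)

/-- The Riemann map of `𝔻` onto `D` normalised at `0`. [folklore] -/
def discMap : ConformalEquiv (ball (0 : ℂ) 1) D.toMarkedDomain.carrier :=
  D.toMarkedDomain.toJordanDomain.normalisedMap D.zero_mem

/-- Its Carathéodory extension. [folklore] -/
def discExt : ℂ → ℂ := D.toMarkedDomain.toJordanDomain.caratheodoryExt D.discMap

/-- The circle preimage of `a`. [folklore] -/
def preA : ℂ :=
  ((D.toMarkedDomain.toJordanDomain.caratheodoryExt_spec D.discMap).2.2.2.surjOn
    (D.toMarkedDomain.pt_mem_frontier 0)).choose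

/-- The circle preimage of `b`. [folklore] -/
def preB : ℂ :=
  ((D.toMarkedDomain.toJordanDomain.caratheodoryExt_spec D.discMap).2.2.2.surjOn
    (D.toMarkedDomain.pt_mem_frontier 1)).choose

/-- `preA` is a circle point over `a`. [folklore] -/
theorem preA_spec : D.preA ∈ sphere (0 : ℂ) 1 ∧ D.discExt D.preA = D.toMarkedDomain.pt 0 :=
  ((D.toMarkedDomain.toJordanDomain.caratheodoryExt_spec D.discMap).2.2.2.surjOn
    (D.toMarkedDomain.pt_mem_frontier 0)).choose_spec

/-- `preB` is a circle point over `b`. [folklore] -/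
theorem preB_spec : D.preB ∈ sphere (0 : ℂ) 1 ∧ D.discExt D.preB = D.toMarkedDomain.pt 1 :=
  ((D.toMarkedDomain.toJordanDomain.caratheodoryExt_spec D.discMap).2.2.2.surjOn
    (D.toMarkedDomain.pt_mem_frontier 1)).choose_spec

/-- The two circle preimages are distinct. [folklore] -/
theorem preA_ne_preB : D.preA ≠ D.preB := by
  intro e
  have h1 := D.preA_spec.2
  rw [e, D.preB_spec.2] at h1
  exact D.pt_zero_ne_pt_one h1.symm

/-- **The normalised map of `D`, explicitly.** [cite: LawlerSchrammWerner2004, §4.3] -/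
def lswMap : ConformalEquiv upperHalfPlaneSet D.toMarkedDomain.carrier :=
  lswOf D.discMap D.preA D.preB (mem_sphere_zero_iff_norm.1 D.preB_spec.1)

/-- The explicit map is chordal uniformizing with `|φ⁻¹(0)| = 1`. [cite: LawlerSchrammWerner2004, §4.3] -/
theorem lswMap_spec : D.toMarkedDomain.IsChordalUniformizing D.lswMap ∧ ‖D.lswMap.symm 0‖ = 1 := by
  obtain ⟨hc, heq, -, -⟩ := D.toMarkedDomain.toJordanDomain.caratheodoryExt_spec D.discMap
  have hF0 : D.discMap 0 = 0 := (D.toMarkedDomain.toJordanDomain.normalisedMap_spec D.zero_mem).1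
  refine ⟨?_, ?_⟩
  · exact isChordalUniformizing_lswOf D.toMarkedDomain D.discMap hc heq
      (mem_sphere_zero_iff_norm.1 D.preA_spec.1) (mem_sphere_zero_iff_norm.1 D.preB_spec.1)
      D.preA_ne_preB D.preA_spec.2 D.preB_spec.2
  · have := norm_lswOf_symm D.discMap D.preA D.preB (mem_sphere_zero_iff_norm.1 D.preB_spec.1)
    rwa [hF0] at this

/-- **Formula for the normalised map of `D`** on `ℍ`: `φ(z) = Ψ (ζb · C(c z + u))`.
[cite: LawlerSchrammWerner2004, §4.3] -/
theorem apply_eq {φ : ConformalEquiv upperHalfPlaneSet D.toMarkedDomain.carrier}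
    (hφ : D.toMarkedDomain.IsChordalUniformizing φ) (hφ1 : ‖φ.symm 0‖ = 1) {z : ℂ}
    (hz : z ∈ upperHalfPlaneSet) : φ z = D.discExt (lswMoebius D.preA D.preB z) := by
  obtain ⟨-, heq, -, -⟩ := D.toMarkedDomain.toJordanDomain.caratheodoryExt_spec D.discMap
  have hw := lswMoebius_mem_ball D.preA D.preB (mem_sphere_zero_iff_norm.1 D.preB_spec.1) hz
  rw [MarkedDomain.eqOn_of_isChordalUniformizing_of_norm_eq_one hφ D.lswMap_spec.1 D.zero_mem hφ1
    D.lswMap_spec.2 hz, lswMap, lswOf_apply, discExt, heq hw]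

end SmoothDomain

/-! ### The convergence of the normalised maps -/

/-- **[LSW04] p. 977: `lim_{R → ∞} R⁻¹ φ_R⁻¹(z) = φ⁻¹(z)` uniformly in `ℍ̄`** — in the tree's
orientation (maps `ℍ → D^R`, `ℍ → D`): along grid approximations `D^{Rₙ}` of a smooth domain at
scales `Rₙ → ∞`, for the normalised maps `φₙ : ℍ → D^{Rₙ}` (`0 ↦ a^{Rₙ}`, `∞ ↦ b^{Rₙ}`,
`|φₙ⁻¹(0)| = 1`) and `φ_D : ℍ → D` (`0 ↦ a`, `∞ ↦ b`, `|φ_D⁻¹(0)| = 1`), `Rₙ⁻¹ φₙ → φ_D` uniformly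
on `ℍ`. This is the hypothesis `hconv` of `drivingProcess_tendsto_of_thm44`, which LSW take "e.g.,
from Cor. 2.4 in [Po]"; proved here from Radó's theorem (Pommerenke Thm. 2.11,
`JordanDomain.rado_tendstoUniformlyOn_holds`) applied to the re-timed boundary loops of
`LSW2004USTApproxLoops.lean`, the convergence of the circle preimages of the marked vertices, the
explicit form of the normalised maps and the uniform convergence of their Möbius parts.
[cite: LawlerSchrammWerner2004, §4.3] -/
theorem tendstoUniformlyOn_lswMaps (D : SmoothDomain) (R : ℕ → ℝ) (Δ : ℕ → Domain)
    (hR : Tendsto R atTop atTop) (hΔ : ∀ n, IsApproximation D (R n) (Δ n))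
    (φD : ConformalEquiv upperHalfPlaneSet D.toMarkedDomain.carrier)
    (hφD : D.toMarkedDomain.IsChordalUniformizing φD) (hφD1 : ‖φD.symm 0‖ = 1)
    (φ : ∀ n, ConformalEquiv upperHalfPlaneSet (Δ n).carrier) (hφ : ∀ n, (Δ n).IsLSWMap (φ n)) :
    TendstoUniformlyOn (fun n z ↦ ((R n : ℂ))⁻¹ * φ n z) φD atTop upperHalfPlaneSet := by
  classical
  -- the limit objects
  obtain ⟨hg0, hgre, hgim⟩ := D.toMarkedDomain.toJordanDomain.normalisedMap_spec D.zero_mem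
  obtain ⟨hΦc, hΦeq, hΦbij, -⟩ := D.toMarkedDomain.toJordanDomain.caratheodoryExt_spec D.discMap
  -- the packed sequence (limit objects as fallback below the gluing scale)
  let pack : ℕ → Σ G : JordanDomain, ConformalEquiv (ball (0 : ℂ) 1) G.carrier := fun n ↦
    if hn : D.glueScale ≤ R n then ⟨(hΔ n).jordan hn, (hΔ n).discMap hn⟩
    else ⟨D.toMarkedDomain.toJordanDomain, D.discMap⟩
  have hgood : ∀ n (hn : D.glueScale ≤ R n), pack n = ⟨(hΔ n).jordan hn, (hΔ n).discMap hn⟩ :=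
    fun n hn ↦ dif_pos hn
  have hbad : ∀ n, ¬ D.glueScale ≤ R n → pack n = ⟨D.toMarkedDomain.toJordanDomain, D.discMap⟩ :=
    fun n hn ↦ dif_neg hn
  -- normalisation of the packed maps
  have hnorm : ∀ n, (pack n).2 0 = D.discMap 0 ∧ 0 < (deriv ((pack n).2) 0).re ∧
      (deriv ((pack n).2) 0).im = 0 := by
    intro n
    by_cases hn : D.glueScale ≤ R n
    · rw [hgood n hn]
      obtain ⟨h1, h2, h3⟩ := ((hΔ n).jordan hn).normalisedMap_spec ((hΔ n).zero_mem_jordan hn)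
      exact ⟨h1.trans hg0.symm, h2, h3⟩
    · rw [hbad n hn]
      exact ⟨rfl, hgre, hgim⟩
  -- uniform convergence of the boundary loops
  have hJ : TendstoUniformly (fun n ↦ (pack n).1.boundary) D.toMarkedDomain.boundary atTop := by
    rw [Metric.tendstoUniformly_iff]
    intro ε hε
    filter_upwards [eventually_dist_jordan_boundary_lt D hR hΔ hε] with n hn t
    obtain ⟨hn, hlt⟩ := hn
    rw [hgood n hn, dist_comm]
    exact hlt t
  -- Radó's theorem, closed-disc form, for the Carathéodory extensions
  set Ext : ℕ → ℂ → ℂ := fun n ↦ (pack n).1.caratheodoryExt (pack n).2 with hExt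
  have hrado : TendstoUniformlyOn Ext D.discExt atTop (closedBall (0 : ℂ) 1) :=
    JordanDomain.rado_tendstoUniformlyOn.closedBall JordanDomain.rado_tendstoUniformlyOn_holds
      (fun n ↦ (pack n).1) D.toMarkedDomain.toJordanDomain (fun n ↦ (pack n).2) D.discMap (fun n ↦ (hnorm n).1)
      (fun n ↦ (hnorm n).2) ⟨hgre, hgim⟩ hJ Ext D.discExt
      (fun n ↦ ((pack n).1.caratheodoryExt_spec (pack n).2).1)
      (fun n ↦ ((pack n).1.caratheodoryExt_spec (pack n).2).2.1) hΦc hΦeq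
  have hExt_good : ∀ n (hn : D.glueScale ≤ R n), Ext n = (hΔ n).discExt hn := fun n hn ↦ by
    show (pack n).1.caratheodoryExt (pack n).2 = _
    rw [hgood n hn]
    rfl
  -- the circle preimages of the marked vertices converge
  let ζas : ℕ → ℂ := fun n ↦ if hn : D.glueScale ≤ R n then (hΔ n).preA hn else D.preA
  let ζbs : ℕ → ℂ := fun n ↦ if hn : D.glueScale ≤ R n then (hΔ n).preB hn else D.preB
  have hsphA : ∀ n, ζas n ∈ closedBall (0 : ℂ) 1 := fun n ↦ by
    by_cases hn : D.glueScale ≤ R n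
    · simp only [ζas, dif_pos hn]; exact sphere_subset_closedBall ((hΔ n).preA_spec hn).1
    · simp only [ζas, dif_neg hn]; exact sphere_subset_closedBall D.preA_spec.1
  have hsphB : ∀ n, ζbs n ∈ closedBall (0 : ℂ) 1 := fun n ↦ by
    by_cases hn : D.glueScale ≤ R n
    · simp only [ζbs, dif_pos hn]; exact sphere_subset_closedBall ((hΔ n).preB_spec hn).1
    · simp only [ζbs, dif_neg hn]; exact sphere_subset_closedBall D.preB_spec.1
  have hinv : Tendsto (fun n ↦ (R n)⁻¹) atTop (𝓝 0) := tendsto_inv_atTop_zero.comp hR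
  have hvalA : Tendsto (fun n ↦ Ext n (ζas n)) atTop (𝓝 (D.discExt D.preA)) := by
    rw [D.preA_spec.2]
    refine Metric.tendsto_nhds.2 fun ε hε ↦ ?_
    have h12 : Tendsto (fun n ↦ 12 * (R n)⁻¹) atTop (𝓝 (12 * 0)) := hinv.const_mul 12
    rw [mul_zero] at h12
    filter_upwards [hR.eventually_ge_atTop D.glueScale, (tendsto_order.1 h12).2 ε hε] with n hn hn'
    rw [hExt_good n hn]
    simp only [ζas, dif_pos hn, ((hΔ n).preA_spec hn).2]
    exact (((hΔ n).dist_a_le hn).trans_eq (by rw [div_eq_mul_inv])).trans_lt hn'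
  have hvalB : Tendsto (fun n ↦ Ext n (ζbs n)) atTop (𝓝 (D.discExt D.preB)) := by
    rw [D.preB_spec.2]
    refine Metric.tendsto_nhds.2 fun ε hε ↦ ?_
    have h12 : Tendsto (fun n ↦ 12 * (R n)⁻¹) atTop (𝓝 (12 * 0)) := hinv.const_mul 12
    rw [mul_zero] at h12
    filter_upwards [hR.eventually_ge_atTop D.glueScale, (tendsto_order.1 h12).2 ε hε] with n hn hn'
    rw [hExt_good n hn]
    simp only [ζbs, dif_pos hn, ((hΔ n).preB_spec hn).2]
    exact (((hΔ n).dist_b_le hn).trans_eq (by rw [div_eq_mul_inv])).trans_lt hn'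
  have hζa : Tendsto ζas atTop (𝓝 D.preA) :=
    tendsto_of_tendstoUniformlyOn_of_injOn (isCompact_closedBall 0 1) hrado hΦc hΦbij.injOn hsphA
      (sphere_subset_closedBall D.preA_spec.1) hvalA
  have hζb : Tendsto ζbs atTop (𝓝 D.preB) :=
    tendsto_of_tendstoUniformlyOn_of_injOn (isCompact_closedBall 0 1) hrado hΦc hΦbij.injOn hsphB
      (sphere_subset_closedBall D.preB_spec.1) hvalB
  -- the Möbius parts converge uniformly on `ℍ`
  have hM := tendstoUniformlyOn_lswMoebius hζa hζb (mem_sphere_zero_iff_norm.1 D.preB_spec.1)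
    D.preA_ne_preB
  -- uniform continuity of the limit extension on the closed disc
  have huc : UniformContinuousOn D.discExt (closedBall (0 : ℂ) 1) :=
    (isCompact_closedBall 0 1).uniformContinuousOn_of_continuous hΦc
  -- conclusion
  rw [Metric.tendstoUniformlyOn_iff]
  intro ε hε
  obtain ⟨δ, hδ, hδ'⟩ := Metric.uniformContinuousOn_iff.1 huc (ε / 2) (half_pos hε)
  filter_upwards [hR.eventually_ge_atTop D.glueScale, Metric.tendstoUniformlyOn_iff.1 hrado (ε / 2) (half_pos hε),
    Metric.tendstoUniformlyOn_iff.1 hM δ hδ] with n hn hrad hmob z hz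
  have hbD := mem_sphere_zero_iff_norm.1 D.preB_spec.1
  have hbn := mem_sphere_zero_iff_norm.1 ((hΔ n).preB_spec hn).1
  have e1 : φD z = D.discExt (lswMoebius D.preA D.preB z) := D.apply_eq hφD hφD1 hz
  have e2 : ((R n : ℂ))⁻¹ * φ n z = (hΔ n).discExt hn (lswMoebius ((hΔ n).preA hn) ((hΔ n).preB hn) z) :=
    (hΔ n).inv_mul_apply_eq hn (hφ n) hz
  have hw : lswMoebius D.preA D.preB z ∈ closedBall (0 : ℂ) 1 :=
    ball_subset_closedBall (lswMoebius_mem_ball _ _ hbD hz)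
  have hwn : lswMoebius ((hΔ n).preA hn) ((hΔ n).preB hn) z ∈ closedBall (0 : ℂ) 1 :=
    ball_subset_closedBall (lswMoebius_mem_ball _ _ hbn hz)
  have hmob' : dist (lswMoebius D.preA D.preB z) (lswMoebius ((hΔ n).preA hn) ((hΔ n).preB hn) z) < δ := by
    have := hmob z hz
    simp only [ζas, ζbs, dif_pos hn] at this
    exact this
  have d1 : dist (D.discExt (lswMoebius D.preA D.preB z))
      (D.discExt (lswMoebius ((hΔ n).preA hn) ((hΔ n).preB hn) z)) < ε / 2 := hδ' _ hw _ hwn hmob'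
  have d2 : dist (D.discExt (lswMoebius ((hΔ n).preA hn) ((hΔ n).preB hn) z))
      ((hΔ n).discExt hn (lswMoebius ((hΔ n).preA hn) ((hΔ n).preB hn) z)) < ε / 2 := by
    have := hrad _ hwn
    rwa [hExt_good n hn] at this
  rw [e1, e2]
  linarith [dist_triangle (D.discExt (lswMoebius D.preA D.preB z))
    (D.discExt (lswMoebius ((hΔ n).preA hn) ((hΔ n).preB hn) z))
    ((hΔ n).discExt hn (lswMoebius ((hΔ n).preA hn) ((hΔ n).preB hn) z))]

/-! ### [LSW04] Thm. 4.4 as printed implies `drivingProcess_tendsto` -/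

open scoped PathBorel in

/-- **`drivingProcess_tendsto` from [LSW04] Thm. 4.4 alone.** With the convergence of the
normalised maps proved (`tendstoUniformlyOn_lswMaps`), the reduction
`drivingProcess_tendsto_of_thm44` (`LSW2004USTDriving.lean`) needs only its hypothesis `h44` —
Theorem 4.4 as printed (p. 976; coupling form, `rad₀(D) > r₁` as `B(0, r₁) ⊆ D`, the
harmonic-measure proviso as `arg φ(0) ∈ [ε₁π, (1 - ε₁)π]`). So the debt carried by the named
fact `drivingProcess_tendsto` is now exactly [LSW04] Thm. 4.4 (the UST theory of §4.1–4.2 with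
§5: Wilson's algorithm, Prop. 4.2, Prop. 4.3, Skorokhod embedding, Koebe distortion).
[cite: LawlerSchrammWerner2004, Thm. 4.4] -/
theorem drivingProcess_tendsto_of_thm44_printed
    (h44 : ∀ (ε₁ ε₂ ε₃ T : ℝ), 0 < ε₁ → 0 < ε₂ → 0 < ε₃ → 0 < T → ∃ r₁ : ℝ, ∀ (Δ : Domain),
      (0 : ℂ) ∈ Δ.carrier → ball (0 : ℂ) r₁ ⊆ Δ.carrier →
      ∀ (φ : ConformalEquiv upperHalfPlaneSet Δ.carrier), Δ.IsLSWMap φ →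
        ε₁ * π ≤ arg (φ.symm 0) → arg (φ.symm 0) ≤ (1 - ε₁) * π →
        ∀ (Γ : PeanoPath Δ → C(ℝ≥0, ℂ)) (W : PeanoPath Δ → C(ℝ≥0, ℝ)),
          (∀ γ, IsCapacityImage Δ φ γ (Γ γ) (W γ)) →
          ∃ ρ : MeasureTheory.Measure (C(ℝ≥0, ℝ) × C(ℝ≥0, ℝ)), ρ.fst = (ustLaw Δ).map W ∧
            ρ.snd = Process.preWienerMeasure.map brownianTimeEight ∧
            ρ {p | ∃ t : ℝ≥0, (t : ℝ) ≤ T ∧ ε₂ < dist (p.1 t) (p.2 t)} < ENNReal.ofReal ε₃) :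
    drivingProcess_tendsto :=
  drivingProcess_tendsto_of_thm44 h44 fun D R Δ hR hΔ φD hφD hφD1 φ hφ ↦
    tendstoUniformlyOn_lswMaps D R Δ hR hΔ φD hφD hφD1 φ hφ

end USTPeano

end Literature.Probability.RandomPlanarGeometry
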